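import Mathlib.LinearAlgebra.Matrix.Rank
import Mathlib.LinearAlgebra.Matrix.NonsingularInverse
import HarnessLib

/-!
# Rank and minors of a matrix over a field

Topic `Literature/LinearAlgebra/Matrix`. The classical characterisation of the rank of a matrix
over a field by its minors: `rank A ≥ s` iff some `s × s` submatrix (minor) has non-zero
determinant; equivalently `rank A ≤ s` iff every `(s+1) × (s+1)` minor vanishes. Mathlib (at the
pinned version) has the ingredients (`Matrix.rank_submatrix_le`, `Matrix.rank_of_isUnit`,
`Matrix.linearIndependent_rows_iff_isUnit`, `exists_linearIndependent'`) but not the statement.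

## Content

* `det_submatrix_eq_zero_of_rank_lt_card` — if `rank A < |ι|` then every `ι × ι` minor vanishes.
* `exists_det_submatrix_ne_zero_of_le_rank` — if `s ≤ rank A` then some `s × s` minor, with
  injective row and column selections, is non-zero.
* `le_rank_iff_exists_det_submatrix_ne_zero`, `rank_le_of_det_submatrix_eq_zero`,
  `rank_le_iff_det_submatrix_eq_zero` — the characterisations.

Used by the apolarity bound for linear rank methods
(`Literature/Computability/AlgebraicComplexity/ApolarityBound.lean`).
-/

namespace Literature.LinearAlgebra.Matrix

open _root_.Matrix

variable {F : Type*} [Field F] {m n : Type*} [Fintype n]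

/-- If `rank A < |ι|` then every minor of `A` indexed by `ι` vanishes (row and column selections
need not be injective). [folklore] -/
theorem det_submatrix_eq_zero_of_rank_lt_card {ι : Type*} [Fintype ι] [DecidableEq ι]
    (A : Matrix m n F) (r : ι → m) (c : ι → n) (h : A.rank < Fintype.card ι) :
    (A.submatrix r c).det = 0 := by
  by_contra hne
  have hU : IsUnit (A.submatrix r c) :=
    (Matrix.isUnit_iff_isUnit_det _).2 (isUnit_iff_ne_zero.2 hne)
  have h1 : (A.submatrix r c).rank = Fintype.card ι := Matrix.rank_of_isUnit _ hU
  have h2 : (A.submatrix r c).rank ≤ A.rank := Matrix.rank_submatrix_le A r c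
  omega

/-- A matrix of rank `≥ s` has `s` linearly independent columns (with distinct indices).
[folklore] -/
theorem exists_linearIndependent_cols_of_le_rank {s : ℕ} (A : Matrix m n F) (hs : s ≤ A.rank) :
    ∃ c : Fin s → n, Function.Injective c ∧ LinearIndependent F (fun j => A.col (c j)) := by
  classical
  obtain ⟨κ, a, ha, hspan, hli⟩ := exists_linearIndependent' (K := F) A.col
  haveI : Fintype κ := Fintype.ofInjective a ha
  have hcard : s ≤ Fintype.card κ := by
    have h1 : Module.finrank F (Submodule.span F (Set.range (A.col ∘ a))) = Fintype.card κ :=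
      finrank_span_eq_card hli
    rw [hspan, ← Matrix.rank_eq_finrank_span_cols] at h1
    omega
  let e : Fin s ↪ κ := (Fin.castLEEmb hcard).trans (Fintype.equivFin κ).symm.toEmbedding
  refine ⟨a ∘ e, ha.comp e.injective, ?_⟩
  exact hli.comp e e.injective

/-- If `s ≤ rank A` then some `s × s` minor of `A`, with injective row and column selections, is
non-zero. [folklore] -/
theorem exists_det_submatrix_ne_zero_of_le_rank [Fintype m] {s : ℕ} (A : Matrix m n F)
    (hs : s ≤ A.rank) :
    ∃ (r : Fin s → m) (c : Fin s → n),
      Function.Injective r ∧ Function.Injective c ∧ (A.submatrix r c).det ≠ 0 := by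
  classical
  obtain ⟨c, hc, hli⟩ := exists_linearIndependent_cols_of_le_rank A hs
  -- the `m × s` matrix of the chosen columns has rank `s`
  set B : Matrix m (Fin s) F := A.submatrix id c with hB
  have hBt : LinearIndependent F (Bᵀ).row := by
    have e1 : (Bᵀ).row = fun j => A.col (c j) := by
      funext j i; rfl
    rw [e1]; exact hli
  have hrankBt : (Bᵀ).rank = s := by simpa using hBt.rank_matrix
  -- hence `s` linearly independent rows
  obtain ⟨r, hr, hli'⟩ := exists_linearIndependent_cols_of_le_rank (Bᵀ) hrankBt.ge
  refine ⟨r, c, hr, hc, ?_⟩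
  have hrows : LinearIndependent F (A.submatrix r c).row := by
    have e2 : (A.submatrix r c).row = fun i => (Bᵀ).col (r i) := by
      funext i j; rfl
    rw [e2]; exact hli'
  have hU : IsUnit (A.submatrix r c) := Matrix.linearIndependent_rows_iff_isUnit.1 hrows
  rw [Matrix.isUnit_iff_isUnit_det, isUnit_iff_ne_zero] at hU
  exact hU

/-- **Rank via minors, I.** `s ≤ rank A` iff some `s × s` minor of `A` is non-zero. [folklore] -/
theorem le_rank_iff_exists_det_submatrix_ne_zero [Fintype m] {s : ℕ} (A : Matrix m n F) :
    s ≤ A.rank ↔ ∃ (r : Fin s → m) (c : Fin s → n), (A.submatrix r c).det ≠ 0 := by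
  constructor
  · intro hs
    obtain ⟨r, c, -, -, h⟩ := exists_det_submatrix_ne_zero_of_le_rank A hs
    exact ⟨r, c, h⟩
  · rintro ⟨r, c, h⟩
    by_contra hlt
    exact h (det_submatrix_eq_zero_of_rank_lt_card A r c (by simpa using not_le.1 hlt))

/-- **Rank via minors, II.** If every `(s+1) × (s+1)` minor of `A` vanishes then `rank A ≤ s`.
[folklore] -/
theorem rank_le_of_det_submatrix_eq_zero [Fintype m] {s : ℕ} (A : Matrix m n F)
    (h : ∀ (r : Fin (s + 1) → m) (c : Fin (s + 1) → n), (A.submatrix r c).det = 0) :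
    A.rank ≤ s := by
  by_contra hlt
  obtain ⟨r, c, hne⟩ :=
    (le_rank_iff_exists_det_submatrix_ne_zero A).1 (Nat.succ_le_of_lt (not_le.1 hlt))
  exact hne (h r c)

/-- **Rank via minors, III.** `rank A ≤ s` iff every `(s+1) × (s+1)` minor vanishes. [folklore] -/
theorem rank_le_iff_det_submatrix_eq_zero [Fintype m] {s : ℕ} (A : Matrix m n F) :
    A.rank ≤ s ↔ ∀ (r : Fin (s + 1) → m) (c : Fin (s + 1) → n), (A.submatrix r c).det = 0 :=
  ⟨fun h r c => det_submatrix_eq_zero_of_rank_lt_card A r c (by simpa using Nat.lt_succ_of_le h),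
    rank_le_of_det_submatrix_eq_zero A⟩

/-- A non-zero `ι × ι` minor forces `|ι| ≤ rank A`. [folklore] -/
theorem card_le_rank_of_det_submatrix_ne_zero {ι : Type*} [Fintype ι] [DecidableEq ι]
    (A : Matrix m n F) (r : ι → m) (c : ι → n) (h : (A.submatrix r c).det ≠ 0) :
    Fintype.card ι ≤ A.rank := by
  by_contra hlt
  exact h (det_submatrix_eq_zero_of_rank_lt_card A r c (not_le.1 hlt))

end Literature.LinearAlgebra.Matrix
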